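import Literature.ModelTheory.ExponentialFields.EPolyNormalForm
import Mathlib.Algebra.MvPolynomial.CommRing
import HarnessLib

/-!
# Wilkie 1996, §10 / den Besten, Theorem 7.2.1: the smoothness condition `S₂` for `T_e` with bounded witnesses

Topic `Literature/ModelTheory/ExponentialFields`.  M. den Besten, *Wilkie's Theorem and the
Uniform Real Schanuel Conjecture* (MSc thesis, Utrecht 2016), Definition 7.1.20 (ii) and
Theorem 7.2.1 ("We show that `T_e` satisfies `S₂`", pp. 91–92): by the model completeness of `T_e`
every `L_e`-formula `φ(x̄)` is equivalent to `∃ ȳ ρ(ȳ, e(ȳ), x̄, e(x̄)) = 0` ((48),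
`EPolyNormalForm.lean`), and the witnesses `ȳ` can be **bounded** (`‖ȳ‖ ≤ 1`) at the price of
replacing `e` by smooth functions: den Besten inverts the large coordinates, `y_j ↦ y_j⁻¹`,
`e(y_j) ↦ e*(y_j) = e(y_j⁻¹)`, obtaining `2^m` functions `F_s` indexed by the subsets `s` of the
inverted coordinates.  This file proves the bounded form in every model `K` of `T_exp`, with one
deviation of presentation: the **algebraic compactification `y ↦ y / (1 - y²)` of the line**
(`(-1, 1) → K` bijective in a real closed field) replaces the inversion, so that ONE integer
polynomial `P` and the entire function `ẽ(y) = e(y / (1 - y²))` suffice: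

* `SmoothnessS2.exists_clear_denominators` — `P(x̄, ȳ, Ē, F̄) = (Π (1 - y_j²))^D ρ(x̄, (y_j / (1 - y_j²)), Ē, F̄)`;
* `SmoothnessS2.exists_abs_lt_one_div_eq` — every `w` is `y / (1 - y²)` with `|y| < 1`;
* `SmoothnessS2.exists_bounded_presentation` — **`S₂` with bounded witnesses**: from
  `rexpTheory.IsModelComplete` (Wilkie's First Main Theorem for `exp↾[0,1]`), for every
  `L_e`-formula `φ(x̄)` there are `m` and `P` with
  `K ⊨ φ(x̄) ↔ ∃ ȳ (|y_j| < 1 ∧ P(x̄, ȳ, e(x̄), ẽ(ȳ)) = 0)` in every model `K` of `T_exp`.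

The functions `(x̄, ȳ) ↦ P(x̄, ȳ, e(x̄), ẽ(ȳ))` are those of `Wilkie1996SmoothFunctions.lean`
(graphs, extreme values, Taylor approximation).  Nothing here is a named fact; no definition is
introduced.

## References

* M. den Besten, *Wilkie's Theorem and the Uniform Real Schanuel Conjecture*, MSc thesis, Utrecht
  (2016): Definition 7.1.20 (ii), Theorem 7.2.1 (pp. 91–92), (48). [DenBesten2016]
* A. J. Wilkie, J. Amer. Math. Soc. 9 (1996), §10 (smooth theories) and Theorem 11.1. [WilkieJAMS1996]
-/

noncomputable section

open FirstOrder FirstOrder.Language FirstOrder.Language.Structure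

namespace Literature.ModelTheory.ExponentialFields

namespace SmoothnessS2

/-! ### Terms of the language of ordered rings are integer polynomials -/

/-- Every term of `(+, ·, -, 0, 1, ≤)` is realized, in a commutative ring, by the evaluation of an
integer polynomial. [folklore] -/
theorem exists_mvPolynomial_realize_eq {ι : Type*} (t : Language.orderedRing.Term ι) :
    ∃ P : MvPolynomial ι ℤ, ∀ (R : Type) [CommRing R] [LE R] (w : ι → R),
      t.realize w = MvPolynomial.aeval w P := by
  induction t with
  | var i => exact ⟨MvPolynomial.X i, fun R _ _ w => by simp⟩
  | func f ts ih =>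
    choose P hP using ih
    cases f with
    | add => exact ⟨P 0 + P 1, fun R _ _ w => by simp [hP]⟩
    | mul => exact ⟨P 0 * P 1, fun R _ _ w => by simp [hP]⟩
    | neg => exact ⟨-P 0, fun R _ _ w => by simp [hP]⟩
    | zero => exact ⟨0, fun R _ _ w => by simp⟩
    | one => exact ⟨1, fun R _ _ w => by simp⟩

/-! ### Clearing the denominators of the substitution `w = y / (1 - y²)` -/

/-- **Clearing denominators.**  For an integer polynomial `ρ(x̄, w̄, Ē, F̄)` (variables
`(Fin n ⊕ Fin m) ⊕ (Fin n ⊕ Fin m)`) there are `D` and an integer polynomial `P` in the same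
variables with `P(x̄, ȳ, Ē, F̄) = (Πⱼ (1 - yⱼ²))^D · ρ(x̄, (yⱼ / (1 - yⱼ²))ⱼ, Ē, F̄)` whenever the
`1 - yⱼ²` are invertible. [folklore] -/
theorem exists_clear_denominators {n m : ℕ}
    (ρ : MvPolynomial ((Fin n ⊕ Fin m) ⊕ (Fin n ⊕ Fin m)) ℤ) :
    ∃ (D : ℕ) (P : MvPolynomial ((Fin n ⊕ Fin m) ⊕ (Fin n ⊕ Fin m)) ℤ),
      ∀ (R : Type) [Field R] (x : Fin n → R) (y : Fin m → R) (E : Fin n → R) (F : Fin m → R),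
        (∀ j, (1 : R) - y j ^ 2 ≠ 0) →
        MvPolynomial.aeval (Sum.elim (Sum.elim x y) (Sum.elim E F)) P =
          (∏ j, (1 - y j ^ 2)) ^ D *
            MvPolynomial.aeval (Sum.elim (Sum.elim x (fun j => y j / (1 - y j ^ 2))) (Sum.elim E F)) ρ := by
  classical
  -- the polynomial `Π_j (1 - Y_j²)` and its partial products
  let U : MvPolynomial ((Fin n ⊕ Fin m) ⊕ (Fin n ⊕ Fin m)) ℤ :=
    ∏ j : Fin m, (1 - MvPolynomial.X (Sum.inl (Sum.inr j)) ^ 2)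
  have hU : ∀ (R : Type) [Field R] (x : Fin n → R) (y : Fin m → R) (E : Fin n → R) (F : Fin m → R),
      MvPolynomial.aeval (Sum.elim (Sum.elim x y) (Sum.elim E F)) U = ∏ j, (1 - y j ^ 2) := by
    intro R _ x y E F
    simp [U, map_prod]
  induction ρ using MvPolynomial.induction_on with
  | C a =>
    refine ⟨0, MvPolynomial.C a, fun R _ x y E F _ => ?_⟩
    simp
  | add p q hp hq =>
    obtain ⟨D₁, P₁, h₁⟩ := hp
    obtain ⟨D₂, P₂, h₂⟩ := hq
    refine ⟨D₁ + D₂, U ^ D₂ * P₁ + U ^ D₁ * P₂, fun R _ x y E F hy => ?_⟩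
    rw [map_add, map_mul, map_mul, map_pow, map_pow, hU, h₁ R x y E F hy, h₂ R x y E F hy,
      map_add]
    ring
  | mul_X p i hp =>
    obtain ⟨D, P, h⟩ := hp
    rcases i with (i | j) | (i | j)
    · refine ⟨D, P * MvPolynomial.X (Sum.inl (Sum.inl i)), fun R _ x y E F hy => ?_⟩
      rw [map_mul, map_mul, h R x y E F hy, MvPolynomial.aeval_X, MvPolynomial.aeval_X]
      simp only [Sum.elim_inl]
      ring
    · -- the variable `w_j`: one more power of the denominators
      refine ⟨D + 1, P * MvPolynomial.X (Sum.inl (Sum.inr j)) *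
        ∏ j' ∈ Finset.univ.erase j, (1 - MvPolynomial.X (Sum.inl (Sum.inr j')) ^ 2),
        fun R _ x y E F hy => ?_⟩
      rw [map_mul, map_mul, map_mul, h R x y E F hy, MvPolynomial.aeval_X, MvPolynomial.aeval_X,
        map_prod]
      simp only [Sum.elim_inl, Sum.elim_inr, map_sub, map_one, map_pow, MvPolynomial.aeval_X]
      rw [pow_succ, ← Finset.mul_prod_erase Finset.univ (fun j => (1 : R) - y j ^ 2) (Finset.mem_univ j)]
      field_simp [hy j]
    · refine ⟨D, P * MvPolynomial.X (Sum.inr (Sum.inl i)), fun R _ x y E F hy => ?_⟩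
      rw [map_mul, map_mul, h R x y E F hy, MvPolynomial.aeval_X, MvPolynomial.aeval_X]
      simp only [Sum.elim_inr]
      ring
    · refine ⟨D, P * MvPolynomial.X (Sum.inr (Sum.inr j)), fun R _ x y E F hy => ?_⟩
      rw [map_mul, map_mul, h R x y E F hy, MvPolynomial.aeval_X, MvPolynomial.aeval_X]
      simp only [Sum.elim_inr]
      ring

/-! ### Solving `w = y / (1 - y²)` with `|y| < 1` in the models of `T_exp` -/

/-- In a model of `T_exp` (a real closed field) every `w` is `y / (1 - y²)` for some `y` with
`|y| < 1` (the root `y = (√(1 + 4w²) - 1) / (2w)` of `w y² + y - w`). [folklore] -/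
theorem exists_abs_lt_one_div_eq (K : Language.Theory.ModelType.{0, 0, 0} realExpTheory) (w : K) :
    ∃ y : K, |y| < 1 ∧ y / (1 - y ^ 2) = w := by
  by_cases hw : w = 0
  · exact ⟨0, by simp, by simp [hw]⟩
  obtain ⟨s, hs⟩ := RealExpModel.exists_mul_self_eq (show (0 : K) ≤ 1 + 4 * w ^ 2 by positivity)
  -- take the non-negative square root
  obtain ⟨s, hs, hs0⟩ : ∃ s : K, s * s = 1 + 4 * w ^ 2 ∧ 0 ≤ s := by
    rcases le_total 0 s with h | h
    · exact ⟨s, hs, h⟩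
    · exact ⟨-s, by rw [neg_mul_neg]; exact hs, neg_nonneg.2 h⟩
  have hs1 : 1 < s := by
    have h4 : (0 : K) < 4 * w ^ 2 := by positivity
    nlinarith
  refine ⟨(s - 1) / (2 * w), ?_, ?_⟩
  · rw [abs_div, abs_of_pos (by linarith : (0 : K) < s - 1), div_lt_one (by positivity)]
    -- `s - 1 < 2 |w|` iff `s² < (1 + 2|w|)²`
    have habs : |2 * w| = 2 * |w| := by rw [abs_mul, abs_of_pos (by norm_num : (0 : K) < 2)]
    rw [habs]
    have hwpos : 0 < |w| := abs_pos.2 hw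
    nlinarith [abs_mul_abs_self w, sq_abs w]
  · have h2w : (2 : K) * w ≠ 0 := mul_ne_zero two_ne_zero hw
    have hden : (1 : K) - ((s - 1) / (2 * w)) ^ 2 ≠ 0 := by
      rw [div_pow, sub_ne_zero, ne_comm, Ne, div_eq_one_iff_eq (pow_ne_zero 2 h2w)]
      intro h
      have : (s - 1) ^ 2 = 4 * w ^ 2 := by rw [h]; ring
      nlinarith
    rw [div_eq_iff hden]
    field_simp
    nlinarith [hs]

/-! ### `S₂` for `T_e` with bounded witnesses -/

/-- **The smoothness condition `S₂` for `T_e` with bounded witnesses** (den Besten 2016,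
Theorem 7.2.1, "We show that `T_e` satisfies `S₂`", and Definition 7.1.20 (ii); here from
Wilkie's First Main Theorem for `exp↾[0,1]`, `rexpTheory.IsModelComplete`, through the normal
form (48) of `EPolyNormalForm.lean`): every `L_e`-formula `φ(x̄)` is equivalent, in every model
`K` of `T_exp`, to `∃ ȳ (|yⱼ| < 1 ∧ P(x̄, ȳ, e(x̄), ẽ(ȳ)) = 0)` for one integer polynomial `P`,
where `ẽ(y) = e(y / (1 - y²))` (`= 1` at `y² = 1`).  (den Besten bounds the witnesses by the
inversion `yⱼ ↦ yⱼ⁻¹` and the function `e*(y) = e(y⁻¹)`, at the price of `2^m` functions indexed by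
the subsets `s`; the algebraic compactification `y ↦ y / (1 - y²)` of the line gives one.)
[cite: DenBesten2016, Theorem 7.2.1 (S₂) and Definition 7.1.20 (ii)] -/
theorem exists_bounded_presentation (hMC : rexpTheory.IsModelComplete) {n : ℕ}
    (φ : Language.orderedERing.Formula (Fin n)) :
    ∃ (m : ℕ) (P : MvPolynomial ((Fin n ⊕ Fin m) ⊕ (Fin n ⊕ Fin m)) ℤ),
      ∀ (K : Language.Theory.ModelType.{0, 0, 0} realExpTheory) (x : Fin n → K),
        φ.Realize x ↔ ∃ y : Fin m → K, (∀ j, |y j| < 1) ∧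
          MvPolynomial.aeval (Sum.elim (Sum.elim x y) (Sum.elim (fun i => EFun.e (x i))
            (fun j => if y j ^ 2 = 1 then 1 else EFun.e (y j / (1 - y j ^ 2))))) P = 0 := by
  classical
  obtain ⟨m, ρ, hρ⟩ := RealExpModel.exists_ePoly_iff_of_rexp_isModelComplete hMC φ
  obtain ⟨ρP, hρP⟩ := exists_mvPolynomial_realize_eq ρ
  obtain ⟨D, P, hP⟩ := exists_clear_denominators ρP
  refine ⟨m, P, fun K x => ?_⟩
  rw [hρ K x]
  have hlt1 : ∀ {y : K}, |y| < 1 → 1 - y ^ 2 ≠ 0 := fun {y} hy => by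
    have : y ^ 2 < 1 := by
      have h := abs_lt.1 hy
      nlinarith [h.1, h.2]
    exact sub_ne_zero.2 (ne_of_gt this)
  have hlt1' : ∀ {y : K}, |y| < 1 → y ^ 2 ≠ 1 := fun {y} hy h =>
    hlt1 hy (by rw [h, sub_self])
  constructor
  · rintro ⟨w, hw⟩
    choose y hy hyw using fun j => exists_abs_lt_one_div_eq K (w j)
    refine ⟨y, hy, ?_⟩
    rw [hP K x y (fun i => EFun.e (x i)) _ fun j => hlt1 (hy j)]
    have hpt : RealExpModel.ePt (Sum.elim x w) =
        Sum.elim (Sum.elim x (fun j => y j / (1 - y j ^ 2)))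
          (Sum.elim (fun i => EFun.e (x i))
            (fun j => if y j ^ 2 = 1 then 1 else EFun.e (y j / (1 - y j ^ 2)))) := by
      funext v
      rcases v with (i | j) | (i | j)
      · rfl
      · show w j = y j / (1 - y j ^ 2)
        rw [hyw]
      · rfl
      · show EFun.e (w j) = (if y j ^ 2 = 1 then 1 else EFun.e (y j / (1 - y j ^ 2)))
        rw [if_neg (hlt1' (hy j)), hyw]
    rw [hρP, hpt] at hw
    rw [hw, mul_zero]
  · rintro ⟨y, hy, hyP⟩
    refine ⟨fun j => y j / (1 - y j ^ 2), ?_⟩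
    rw [hρP]
    rw [hP K x y (fun i => EFun.e (x i)) _ fun j => hlt1 (hy j)] at hyP
    have hpt : RealExpModel.ePt (Sum.elim x fun j => y j / (1 - y j ^ 2)) =
        Sum.elim (Sum.elim x (fun j => y j / (1 - y j ^ 2)))
          (Sum.elim (fun i => EFun.e (x i))
            (fun j => if y j ^ 2 = 1 then 1 else EFun.e (y j / (1 - y j ^ 2)))) := by
      funext v
      rcases v with (i | j) | (i | j)
      · rfl
      · rfl
      · rfl
      · show EFun.e (y j / (1 - y j ^ 2)) = (if y j ^ 2 = 1 then 1 else EFun.e (y j / (1 - y j ^ 2)))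
        rw [if_neg (hlt1' (hy j))]
    rw [hpt]
    have hprod : (∏ j, ((1 : K) - y j ^ 2)) ^ D ≠ 0 :=
      pow_ne_zero _ (Finset.prod_ne_zero_iff.2 fun j _ => hlt1 (hy j))
    exact (mul_eq_zero.1 hyP).resolve_left hprod

end SmoothnessS2

end Literature.ModelTheory.ExponentialFields
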